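import Summits.QuantumFields.BalabanUV.Beta.FP.RelInvPeriodised
import Summits.QuantumFields.BalabanUV.Beta.FP.KernelPeriodisationFibLoc
import Summits.QuantumFields.BalabanUV.Beta.D1BFx.SortedEmbedding
import Summits.QuantumFields.BalabanUV.Beta.D1BFx.KLimitAxial

/-!
# `BalabanUV.Beta.FP.PackedLegFullIndex` — road «FP» (binder row D1), ROUTE T, (T-PER) PART 4⁗ = **(P2⁗): FROM THE PACKED SORTS TO THE FIBRED TORUS
# INDEX — the packed leg `fromBlocks Γ♯ I♯ L♯ (−S♯)` of a sliced system (leaf-05 g31 `PackedLegBlocksAtSlices`, the OWNER d1-p3's #27 `PackedLegBlocks`,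
# #24 `KernelDoorLegCurrency`) IS the restriction along the packing injection `e♯ = Sum.elim (b ↦ (b.1, inl b.2)) fμ` of ONE full-index matrix
# `D_σ·(Ê·P·Ê)` (`P` = the periodised chart kernel `perF M A`, `Ê = perF M (axEc ρ Lc)` = an2's live indicator as a 0∕1 diagonal, `D_σ` = the
# field∕multiplier sign twist), whose complement is DEAD; hence `hessT` of the packed leg against `e♯`-restricted jets IS `hessT` on `Idx M (Fib d)`
# of `Ê·P·Ê` (= `P` under the torus rules `Ê·P = P = P·Ê` of `RelInvPeriodisedChart.perF_rules_of_relInv` ∕ `…Comb.perF_rules_comb`) against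
# SIGN-TWISTED jets — the currency of (P2″)∕(P2‴) (`KernelPeriodisationFibTraceTwoBound` ∕ `…FibHessKer`)**

WHY (TID § F.8 STEP 3, § F.10 (L1); the junction between #24's `hessT (X.submatrix e e) …` on the packed sorts `(pbox M × Fin (d+1)) ⊕ μ` and the
(P2″)∕(P2‴) limits, which live on `Idx M (Fib d) = pbox M × (Fin (d+1) ⊕ Fin (d+1))`).  Road BF-x's generic letter `D1BFx.SortedEmbedding.
hessT_submatrix_of_dead_leg` (leaf-03 g8: ONLY the leg needs dead rows and columns off `range e`; the jets are arbitrary) does the transfer once the leg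
is presented as the restriction of a full-index matrix with a dead complement; this file supplies that presentation for the road's displayed leg
blocks (`Γ♯ = of (axEc·axEc·P)`, `I♯ = of (axEc·P (·, fμ ·))`, `L♯ = −of (axEc·P (fμ ·, ·))`, `S♯ = P.submatrix fμ fμ` — EXACTLY the right-hand
sides of leaf-05's `packedLeg_oneShot_eq ∕ packedLeg_comb_eq`, for ANY `P`), reads the dead complement off `axEc`'s multiplier diagonal (`hcoarse`:
the coarse multipliers `fμ` sit exactly at the root sites), and moves the sign twist from the leg into the jets by cyclicity of the trace.
CONTENT ([folklore] finite bookkeeping; no `def`, no `def … : Prop`, nothing cited, 0 sorry; 0 estimates):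
* §1 `hessT_conj_transfer` (`hessT (D₁·P·D₂) V V′ W = hessT P (D₂·V·D₁) …`, any square matrices, `Matrix.trace_mul_comm`); the one-sided form is road
  BF-x's `D1BFx.KLimitAxial.hessT_mul_leg` («THE SIGN MOVES»), consumed BY NAME.
* §2 the packing injection `e♯ := Sum.elim (fun b => (b.1, Sum.inl b.2)) fμ` (written in full, no `def`): `packedEmb_injective`, `not_mem_range_packedEmb`,
  `axEc_diag_eq_zero_of_not_mem_range` (off `range e♯` the live indicator vanishes, by `hcoarse`), `axEc_diag_fμ_eq_one` (at `fμ a` it is `1`, by `hμ` + `hcoarse`).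
* §3 `submatrix_packedEmb_eq_fromBlocks` (any full-index matrix read along `e♯` = `fromBlocks` of its four sub-blocks — the consumer's shape for the (J-a) jet presentations); **`signMaskLeg_submatrix_eq_fromBlocks`**: `(D_σ·(D_ε·P·D_ε)).submatrix e♯ e♯ = fromBlocks Γ♯ I♯ L♯ (−S♯)` for ANY `P`, `D_ε = diagonal (axEc-diagonal)`,
  `D_σ = diagonal (+1 on field slots, −1 on multiplier slots)`.
* §4 `signMaskLeg_row_dead ∕ _col_dead`: `D_σ·(D_ε·P·D_ε)` has zero rows and columns off `range e♯`.
* §5 **`hessT_packedLeg_eq_fullIndex`**: for ANY full-index `P V V′ W`: `hessT (fromBlocks Γ♯ I♯ L♯ (−S♯)) (V.sub e♯) (V′.sub e♯) (W.sub e♯) = hessT (D_ε·P·D_ε) (V·D_σ)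
  (V′·D_σ) (W·D_σ)`; **`hessT_packedLeg_eq_perF`**: with `P := perF M A` and the torus rules `Ê·Â = Â = Â·Ê` (`Ê = perF M (axEc ρ Lc) = D_ε` by
  `RelInvPeriodised.perF_axEc`): `= hessT (perF M A) (V·D_σ) (V′·D_σ) (W·D_σ)`.
* §6 the sign twist periodises: `dper_scaleK` (`dper M (scaleK u v U) = scaleK u v (dper M U)`), **`perF_dper_mul_signDiag`** (`perF M (dper M U) · D_σ =
  perF M (dper M (scaleK 1 σ U))`, `σ = Sum.elim 1 (−1)` on `Fib d`), `biLoc_scaleK_sign` (`BiLoc` is kept with the same constant) — so the twisted jets are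
  again `perF ∘ dper` of bi-localised kernels and (P2‴) `KernelPeriodisationFibHessKer.tendsto_hessT_perF` applies verbatim with leg `A` UNMASKED.
What it is NOT: not the (J-a) naming of the jets as `(perF M (dper M 𝒰)).submatrix e♯ e♯` (displayed: the consumer supplies `V V′ W`), not the torus rules
(leaf-05's ∕ an2's letters, consumed BY NAME as hypotheses `hEA hAE`), not (L1), not (C1)(C2).  Moves NO (CONV-C) clause and NO row-D1 binder; NOT (T-ID), NOT SDF,
NOT D1, NOT BetaPertH, NOT continuum, NOT Clay.

HONEST DEPENDENCY (page 1, mandatory): continuum YM on T⁴ ⇐ BetaPertH ∧ nine spine estimates (0/9 proved); BetaPertH ⇐ (D1) ∧ (D4) ∧ CAP+tail;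
G-an2-4 gates asym, D1 and NE2/3/4.  HONEST FRAMING (cell contract, verbatim): «discharging `BetaPertH` makes Bałaban's UV stability UNCONDITIONAL —
a real constructive-QFT result; it is NOT the continuum limit and NOT the Clay problem.»  ABSOLUTE RULE (cell charter, verbatim): «No internally-minted
statement may enter as a cited fact. Every hypothesis is either kernel-proved in this package or a verbatim quotation of a PUBLISHED theorem with page
reference. The manuscript(s) under audit are NOT citable for their own disputed steps — they are the thing under adjudication; programme-internal
(2001/route/tribunal) claims are never citable.»  Nothing of Bałaban's asserted.  D1 formalisation swarm LEAF PROVER 06 (b2b-balaban-beta-d1-formalise-leaf-06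
gen 23), 2026-08-22.  No existing file touched.
-/

noncomputable section

open scoped BigOperators Matrix

namespace Summit.QuantumFields.BalabanUV.Beta.FP.PackedLegFullIndex

open Matrix
open Literature.Probability.LatticeModels (Torus.proj)
open Literature.MathematicalPhysics.QuantumFieldTheory.Balaban1983to89
open Literature.MathematicalPhysics.QuantumFieldTheory.Balaban1983to89.Beta
open B4TorusKernel.MultiPeriod (translate)
open B6Lemma24Torus (pbox)
open ExpKernelCalculus (MKer BiLoc)
open HessKerRate (scaleK scaleK_apply biLoc_scaleK)
open AffineAveraging (Site)
open OneStepResolventKernel (Fib)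
open Summit.QuantumFields.BalabanUV.Beta.AxialDressingRooted (axEc axEc_inl_inl axEc_inr_inr)
open Summit.QuantumFields.BalabanUV.Beta.D1BFx.MixedVarPackedHess (hessT)
open Summit.QuantumFields.BalabanUV.Beta.D1BFx.SortedEmbedding (hessT_submatrix_of_dead_leg)
open Summit.QuantumFields.BalabanUV.Beta.D1BFx.KLimitAxial (hessT_mul_leg)
open Summit.QuantumFields.BalabanUV.Beta.FP.KernelPeriodisationFib (Idx perF perF_scaleK)
open Summit.QuantumFields.BalabanUV.Beta.FP.KernelPeriodisationFibLoc (dper dper_apply)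
open Summit.QuantumFields.BalabanUV.Beta.FP.RelInvPeriodised (perF_axEc)

/-! ## §1 `hessT` with factors moved from the leg into the jets (cyclicity of the trace) -/

section Transfer

variable {ι : Type*} [Fintype ι]

/-- [folklore] **BOTH OUTER FACTORS OF THE LEG MOVE INTO THE JETS**: `hessT (D₁·P·D₂) V V′ W = hessT P (D₂·V·D₁) (D₂·V′·D₁) (D₂·W·D₁)`. -/
theorem hessT_conj_transfer (D₁ P D₂ V V' W : Matrix ι ι ℝ) :
    hessT (D₁ * P * D₂) V V' W = hessT P (D₂ * V * D₁) (D₂ * V' * D₁) (D₂ * W * D₁) := by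
  unfold hessT
  have h1 : (D₁ * P * D₂ * W).trace = (P * (D₂ * W * D₁)).trace := by
    calc (D₁ * P * D₂ * W).trace = (D₁ * (P * D₂ * W)).trace := by simp only [Matrix.mul_assoc]
      _ = (P * D₂ * W * D₁).trace := Matrix.trace_mul_comm _ _
      _ = (P * (D₂ * W * D₁)).trace := by simp only [Matrix.mul_assoc]
  have h2 : (D₁ * P * D₂ * V * (D₁ * P * D₂ * V')).trace = (P * (D₂ * V * D₁) * (P * (D₂ * V' * D₁))).trace := by
    calc (D₁ * P * D₂ * V * (D₁ * P * D₂ * V')).trace = (D₁ * (P * D₂ * V * D₁ * P * D₂ * V')).trace := by simp only [Matrix.mul_assoc]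
      _ = (P * D₂ * V * D₁ * P * D₂ * V' * D₁).trace := Matrix.trace_mul_comm _ _
      _ = (P * (D₂ * V * D₁) * (P * (D₂ * V' * D₁))).trace := by simp only [Matrix.mul_assoc]
  rw [h1, h2]

end Transfer

/-! ## §2 The packing injection `e♯ = Sum.elim (b ↦ (b.1, inl b.2)) fμ` and the live indicator on its range and off it -/

section Packing

variable {d : ℕ} (ρ : Fin (d + 1) → ℤ) (Lc : ℕ) (M : Fin (d + 1) → ℕ)
variable {μ : Type*} (fμ : μ → Idx M (Fib d))

/-- [folklore] **THE PACKING INJECTION IS INJECTIVE**: field slots `b ↦ (b.1, inl b.2)` and coarse multipliers `fμ` (injective, `inr`-valued) never collide. -/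
theorem packedEmb_injective (hfμ : Function.Injective fμ) (hμ : ∀ a : μ, ∃ m : Fin (d + 1), (fμ a).2 = Sum.inr m) :
    Function.Injective (Sum.elim (fun b : ↥(pbox M) × Fin (d + 1) => ((b.1, Sum.inl b.2) : Idx M (Fib d))) fμ) := by
  rintro (b | a) (b' | a') h
  · simp only [Sum.elim_inl, Prod.mk.injEq, Sum.inl.injEq] at h
    exact congrArg Sum.inl (Prod.ext h.1 h.2)
  · simp only [Sum.elim_inl, Sum.elim_inr] at h
    obtain ⟨m, hm⟩ := hμ a'
    have h2 := congrArg Prod.snd h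
    rw [hm] at h2
    exact absurd h2 Sum.inl_ne_inr
  · simp only [Sum.elim_inl, Sum.elim_inr] at h
    obtain ⟨m, hm⟩ := hμ a
    have h2 := congrArg Prod.snd h
    rw [hm] at h2
    exact absurd h2 Sum.inr_ne_inl
  · simp only [Sum.elim_inr] at h
    exact congrArg Sum.inr (hfμ h)

/-- [folklore] **OFF THE RANGE OF THE PACKING INJECTION = a multiplier slot not among the `fμ`.** -/
theorem not_mem_range_packedEmb {p : Idx M (Fib d)}
    (hp : p ∉ Set.range (Sum.elim (fun b : ↥(pbox M) × Fin (d + 1) => ((b.1, Sum.inl b.2) : Idx M (Fib d))) fμ)) :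
    (∃ m : Fin (d + 1), p.2 = Sum.inr m) ∧ p ∉ Set.range fμ := by
  obtain ⟨s, f⟩ := p
  refine ⟨?_, fun ⟨a, ha⟩ => hp ⟨Sum.inr a, by simpa using ha⟩⟩
  rcases f with α | m
  · exact absurd ⟨Sum.inl (s, α), by simp⟩ hp
  · exact ⟨m, rfl⟩

/-- [folklore] **OFF `range e♯` THE LIVE INDICATOR VANISHES**: with `hcoarse` (the `fμ` sit exactly at the multiplier slots over the root sites,
`Torus.proj Lc s = 0`), a multiplier slot not among the `fμ` is over a non-root site, where `axEc`'s multiplier diagonal is `0`. -/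
theorem axEc_diag_eq_zero_of_not_mem_range
    (hcoarse : ∀ (s : ↥(pbox M)) (m : Fin (d + 1)), ((s, Sum.inr m) : Idx M (Fib d)) ∈ Set.range fμ ↔ Torus.proj Lc (s : Site (d + 1)) = 0)
    {p : Idx M (Fib d)} (hp : p ∉ Set.range (Sum.elim (fun b : ↥(pbox M) × Fin (d + 1) => ((b.1, Sum.inl b.2) : Idx M (Fib d))) fμ)) :
    axEc ρ Lc (p.1 : Site (d + 1)) (p.1 : Site (d + 1)) p.2 p.2 = 0 := by
  obtain ⟨⟨m, hm⟩, hr⟩ := not_mem_range_packedEmb M fμ hp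
  obtain ⟨s, f⟩ := p
  simp only at hm
  subst hm
  have hs : Torus.proj Lc (s : Site (d + 1)) ≠ 0 := fun h0 => hr ((hcoarse s m).2 h0)
  show axEc ρ Lc (s : Site (d + 1)) (s : Site (d + 1)) (Sum.inr m) (Sum.inr m) = 0
  rw [axEc_inr_inr, if_neg]
  rintro ⟨-, -, h0⟩
  exact hs h0

/-- [folklore] **AT A COARSE MULTIPLIER `fμ a` THE LIVE INDICATOR IS `1`** (`hμ`: `fμ a` is a multiplier slot; `hcoarse`: it is over a root site). -/
theorem axEc_diag_fμ_eq_one (hμ : ∀ a : μ, ∃ m : Fin (d + 1), (fμ a).2 = Sum.inr m)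
    (hcoarse : ∀ (s : ↥(pbox M)) (m : Fin (d + 1)), ((s, Sum.inr m) : Idx M (Fib d)) ∈ Set.range fμ ↔ Torus.proj Lc (s : Site (d + 1)) = 0)
    (a : μ) :
    axEc ρ Lc ((fμ a).1 : Site (d + 1)) ((fμ a).1 : Site (d + 1)) (fμ a).2 (fμ a).2 = 1 := by
  obtain ⟨m, hm⟩ := hμ a
  have hp : fμ a = ((fμ a).1, Sum.inr m) := Prod.ext rfl hm
  have h0 : Torus.proj Lc ((fμ a).1 : Site (d + 1)) = 0 := (hcoarse (fμ a).1 m).1 ⟨a, hp⟩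
  rw [hm, axEc_inr_inr, if_pos ⟨rfl, rfl, h0⟩]

end Packing

/-! ## §3 The packed leg is the restriction of ONE sign-twisted masked full-index matrix -/

section Leg

variable {d : ℕ} (ρ : Fin (d + 1) → ℤ) (Lc : ℕ) (M : Fin (d + 1) → ℕ)
variable {μ : Type*} (fμ : μ → Idx M (Fib d))

/-- [folklore] **ANY full-index matrix read along `e♯` is the `fromBlocks` of its four (field ∕ multiplier) sub-blocks** — the shape in which the
consumer states the (J-a) jet presentations `V.submatrix e♯ e♯ = fromBlocks K_a (−Q_aᵀ) Q_a 0` block by block. -/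
theorem submatrix_packedEmb_eq_fromBlocks (X : Matrix (Idx M (Fib d)) (Idx M (Fib d)) ℝ) :
    X.submatrix (Sum.elim (fun b : ↥(pbox M) × Fin (d + 1) => ((b.1, Sum.inl b.2) : Idx M (Fib d))) fμ)
        (Sum.elim (fun b : ↥(pbox M) × Fin (d + 1) => ((b.1, Sum.inl b.2) : Idx M (Fib d))) fμ)
      = fromBlocks
          (X.submatrix (fun b : ↥(pbox M) × Fin (d + 1) => ((b.1, Sum.inl b.2) : Idx M (Fib d)))
            (fun b : ↥(pbox M) × Fin (d + 1) => ((b.1, Sum.inl b.2) : Idx M (Fib d))))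
          (X.submatrix (fun b : ↥(pbox M) × Fin (d + 1) => ((b.1, Sum.inl b.2) : Idx M (Fib d))) fμ)
          (X.submatrix fμ (fun b : ↥(pbox M) × Fin (d + 1) => ((b.1, Sum.inl b.2) : Idx M (Fib d))))
          (X.submatrix fμ fμ) := by
  ext (b | a) (b' | a') <;> rfl

/-- [folklore] **`signMaskLeg_submatrix_eq_fromBlocks` — THE DISPLAYED LEG BLOCKS ARE ONE FULL-INDEX MATRIX READ ALONG `e♯`**: for ANY `P` on
`Idx M (Fib d)`, with `D_ε := diagonal (p ↦ axEc ρ Lc p̃ p̃ p.2 p.2)` (the live indicator, `= perF M (axEc ρ Lc)` by `perF_axEc`) and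
`D_σ := diagonal (+1 on field slots, −1 on multiplier slots)`,
`(D_σ · (D_ε · P · D_ε)).submatrix e♯ e♯ = fromBlocks (of (axEc_b·(axEc_{b′}·P b b′))) (of (axEc_b·P b (fμ a))) (−of (axEc_b·P (fμ a) b)) (−P.submatrix fμ fμ)`
— the right-hand side of leaf-05's `packedLeg_oneShot_eq ∕ packedLeg_comb_eq` with `P := perF T A`. -/
theorem signMaskLeg_submatrix_eq_fromBlocks (hμ : ∀ a : μ, ∃ m : Fin (d + 1), (fμ a).2 = Sum.inr m)
    (hcoarse : ∀ (s : ↥(pbox M)) (m : Fin (d + 1)), ((s, Sum.inr m) : Idx M (Fib d)) ∈ Set.range fμ ↔ Torus.proj Lc (s : Site (d + 1)) = 0)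
    (P : Matrix (Idx M (Fib d)) (Idx M (Fib d)) ℝ) :
    (Matrix.diagonal (fun p : Idx M (Fib d) => Sum.elim (fun _ : Fin (d + 1) => (1 : ℝ)) (fun _ : Fin (d + 1) => (-1 : ℝ)) p.2)
        * (Matrix.diagonal (fun p : Idx M (Fib d) => axEc ρ Lc (p.1 : Site (d + 1)) (p.1 : Site (d + 1)) p.2 p.2) * P
            * Matrix.diagonal (fun p : Idx M (Fib d) => axEc ρ Lc (p.1 : Site (d + 1)) (p.1 : Site (d + 1)) p.2 p.2))).submatrix
        (Sum.elim (fun b : ↥(pbox M) × Fin (d + 1) => ((b.1, Sum.inl b.2) : Idx M (Fib d))) fμ)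
        (Sum.elim (fun b : ↥(pbox M) × Fin (d + 1) => ((b.1, Sum.inl b.2) : Idx M (Fib d))) fμ)
      = fromBlocks
          (Matrix.of fun (b b' : ↥(pbox M) × Fin (d + 1)) =>
            axEc ρ Lc (b.1 : Site (d + 1)) (b.1 : Site (d + 1)) (Sum.inl b.2) (Sum.inl b.2)
              * (axEc ρ Lc (b'.1 : Site (d + 1)) (b'.1 : Site (d + 1)) (Sum.inl b'.2) (Sum.inl b'.2)
                * P (b.1, Sum.inl b.2) (b'.1, Sum.inl b'.2)))
          (Matrix.of fun (b : ↥(pbox M) × Fin (d + 1)) (a : μ) =>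
            axEc ρ Lc (b.1 : Site (d + 1)) (b.1 : Site (d + 1)) (Sum.inl b.2) (Sum.inl b.2) * P (b.1, Sum.inl b.2) (fμ a))
          (-Matrix.of fun (a : μ) (b : ↥(pbox M) × Fin (d + 1)) =>
            axEc ρ Lc (b.1 : Site (d + 1)) (b.1 : Site (d + 1)) (Sum.inl b.2) (Sum.inl b.2) * P (fμ a) (b.1, Sum.inl b.2))
          (-(P.submatrix fμ fμ)) := by
  have h1 : ∀ a : μ, axEc ρ Lc ((fμ a).1 : Site (d + 1)) ((fμ a).1 : Site (d + 1)) (fμ a).2 (fμ a).2 = 1 :=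
    axEc_diag_fμ_eq_one ρ Lc M fμ hμ hcoarse
  have hσ : ∀ a : μ, Sum.elim (fun _ : Fin (d + 1) => (1 : ℝ)) (fun _ : Fin (d + 1) => (-1 : ℝ)) (fμ a).2 = -1 := by
    intro a
    obtain ⟨m, hm⟩ := hμ a
    rw [hm, Sum.elim_inr]
  ext (b | a) (b' | a')
  · simp only [submatrix_apply, Sum.elim_inl, diagonal_mul, mul_diagonal, fromBlocks_apply₁₁, of_apply]
    ring
  · simp only [submatrix_apply, Sum.elim_inl, Sum.elim_inr, diagonal_mul, mul_diagonal, fromBlocks_apply₁₂, of_apply, h1]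
    ring
  · simp only [submatrix_apply, Sum.elim_inl, Sum.elim_inr, diagonal_mul, mul_diagonal, fromBlocks_apply₂₁, Matrix.neg_apply, Matrix.of_apply, h1, hσ]
    ring
  · simp only [submatrix_apply, Sum.elim_inr, diagonal_mul, mul_diagonal, fromBlocks_apply₂₂, Matrix.neg_apply, h1, hσ]
    ring

/-- [folklore] **THE MASKED MATRIX HAS DEAD ROWS off `range e♯`** (there the live indicator is `0`). -/
theorem signMaskLeg_row_dead
    (hcoarse : ∀ (s : ↥(pbox M)) (m : Fin (d + 1)), ((s, Sum.inr m) : Idx M (Fib d)) ∈ Set.range fμ ↔ Torus.proj Lc (s : Site (d + 1)) = 0)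
    (P : Matrix (Idx M (Fib d)) (Idx M (Fib d)) ℝ) :
    ∀ k, k ∉ Set.range (Sum.elim (fun b : ↥(pbox M) × Fin (d + 1) => ((b.1, Sum.inl b.2) : Idx M (Fib d))) fμ) → ∀ k',
      (Matrix.diagonal (fun p : Idx M (Fib d) => Sum.elim (fun _ : Fin (d + 1) => (1 : ℝ)) (fun _ : Fin (d + 1) => (-1 : ℝ)) p.2)
        * (Matrix.diagonal (fun p : Idx M (Fib d) => axEc ρ Lc (p.1 : Site (d + 1)) (p.1 : Site (d + 1)) p.2 p.2) * P
            * Matrix.diagonal (fun p : Idx M (Fib d) => axEc ρ Lc (p.1 : Site (d + 1)) (p.1 : Site (d + 1)) p.2 p.2))) k k' = 0 := by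
  intro k hk k'
  have h0 := axEc_diag_eq_zero_of_not_mem_range ρ Lc M fμ hcoarse hk
  simp only [diagonal_mul, mul_diagonal, h0, zero_mul, mul_zero]

/-- [folklore] **… AND DEAD COLUMNS off `range e♯`.** -/
theorem signMaskLeg_col_dead
    (hcoarse : ∀ (s : ↥(pbox M)) (m : Fin (d + 1)), ((s, Sum.inr m) : Idx M (Fib d)) ∈ Set.range fμ ↔ Torus.proj Lc (s : Site (d + 1)) = 0)
    (P : Matrix (Idx M (Fib d)) (Idx M (Fib d)) ℝ) :
    ∀ k', k' ∉ Set.range (Sum.elim (fun b : ↥(pbox M) × Fin (d + 1) => ((b.1, Sum.inl b.2) : Idx M (Fib d))) fμ) → ∀ k,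
      (Matrix.diagonal (fun p : Idx M (Fib d) => Sum.elim (fun _ : Fin (d + 1) => (1 : ℝ)) (fun _ : Fin (d + 1) => (-1 : ℝ)) p.2)
        * (Matrix.diagonal (fun p : Idx M (Fib d) => axEc ρ Lc (p.1 : Site (d + 1)) (p.1 : Site (d + 1)) p.2 p.2) * P
            * Matrix.diagonal (fun p : Idx M (Fib d) => axEc ρ Lc (p.1 : Site (d + 1)) (p.1 : Site (d + 1)) p.2 p.2))) k k' = 0 := by
  intro k' hk' k
  have h0 := axEc_diag_eq_zero_of_not_mem_range ρ Lc M fμ hcoarse hk'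
  simp only [diagonal_mul, mul_diagonal, h0, mul_zero]

end Leg

/-! ## §4 `hessT` of the packed leg against restricted jets IS `hessT` on the fibred torus index against sign-twisted jets -/

section FullIndex

variable {d : ℕ} (ρ : Fin (d + 1) → ℤ) (Lc : ℕ) (M : Fin (d + 1) → ℕ) [∀ μ, NeZero (M μ)]
variable {μ : Type*} [Fintype μ] (fμ : μ → Idx M (Fib d))

omit [∀ μ, NeZero (M μ)] in
/-- [folklore] **`hessT_packedLeg_eq_fullIndex` — FROM THE PACKED SORTS TO THE FIBRED TORUS INDEX**: for ANY full-index `P V V′ W`,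
`hessT (fromBlocks Γ♯ I♯ L♯ (−S♯)) (V.sub e♯ e♯) (V′.sub e♯ e♯) (W.sub e♯ e♯) = hessT (D_ε·P·D_ε) (V·D_σ) (V′·D_σ) (W·D_σ)`
(§3 + `SortedEmbedding.hessT_submatrix_of_dead_leg` + `KLimitAxial.hessT_mul_leg`: the sign twist moves into the jets). -/
theorem hessT_packedLeg_eq_fullIndex (hfμ : Function.Injective fμ) (hμ : ∀ a : μ, ∃ m : Fin (d + 1), (fμ a).2 = Sum.inr m)
    (hcoarse : ∀ (s : ↥(pbox M)) (m : Fin (d + 1)), ((s, Sum.inr m) : Idx M (Fib d)) ∈ Set.range fμ ↔ Torus.proj Lc (s : Site (d + 1)) = 0)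
    (P V V' W : Matrix (Idx M (Fib d)) (Idx M (Fib d)) ℝ) :
    hessT
        (fromBlocks
          (Matrix.of fun (b b' : ↥(pbox M) × Fin (d + 1)) =>
            axEc ρ Lc (b.1 : Site (d + 1)) (b.1 : Site (d + 1)) (Sum.inl b.2) (Sum.inl b.2)
              * (axEc ρ Lc (b'.1 : Site (d + 1)) (b'.1 : Site (d + 1)) (Sum.inl b'.2) (Sum.inl b'.2)
                * P (b.1, Sum.inl b.2) (b'.1, Sum.inl b'.2)))
          (Matrix.of fun (b : ↥(pbox M) × Fin (d + 1)) (a : μ) =>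
            axEc ρ Lc (b.1 : Site (d + 1)) (b.1 : Site (d + 1)) (Sum.inl b.2) (Sum.inl b.2) * P (b.1, Sum.inl b.2) (fμ a))
          (-Matrix.of fun (a : μ) (b : ↥(pbox M) × Fin (d + 1)) =>
            axEc ρ Lc (b.1 : Site (d + 1)) (b.1 : Site (d + 1)) (Sum.inl b.2) (Sum.inl b.2) * P (fμ a) (b.1, Sum.inl b.2))
          (-(P.submatrix fμ fμ)))
        (V.submatrix (Sum.elim (fun b : ↥(pbox M) × Fin (d + 1) => ((b.1, Sum.inl b.2) : Idx M (Fib d))) fμ)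
          (Sum.elim (fun b : ↥(pbox M) × Fin (d + 1) => ((b.1, Sum.inl b.2) : Idx M (Fib d))) fμ))
        (V'.submatrix (Sum.elim (fun b : ↥(pbox M) × Fin (d + 1) => ((b.1, Sum.inl b.2) : Idx M (Fib d))) fμ)
          (Sum.elim (fun b : ↥(pbox M) × Fin (d + 1) => ((b.1, Sum.inl b.2) : Idx M (Fib d))) fμ))
        (W.submatrix (Sum.elim (fun b : ↥(pbox M) × Fin (d + 1) => ((b.1, Sum.inl b.2) : Idx M (Fib d))) fμ)
          (Sum.elim (fun b : ↥(pbox M) × Fin (d + 1) => ((b.1, Sum.inl b.2) : Idx M (Fib d))) fμ))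
      = hessT
          (Matrix.diagonal (fun p : Idx M (Fib d) => axEc ρ Lc (p.1 : Site (d + 1)) (p.1 : Site (d + 1)) p.2 p.2) * P
            * Matrix.diagonal (fun p : Idx M (Fib d) => axEc ρ Lc (p.1 : Site (d + 1)) (p.1 : Site (d + 1)) p.2 p.2))
          (V * Matrix.diagonal (fun p : Idx M (Fib d) => Sum.elim (fun _ : Fin (d + 1) => (1 : ℝ)) (fun _ : Fin (d + 1) => (-1 : ℝ)) p.2))
          (V' * Matrix.diagonal (fun p : Idx M (Fib d) => Sum.elim (fun _ : Fin (d + 1) => (1 : ℝ)) (fun _ : Fin (d + 1) => (-1 : ℝ)) p.2))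
          (W * Matrix.diagonal (fun p : Idx M (Fib d) => Sum.elim (fun _ : Fin (d + 1) => (1 : ℝ)) (fun _ : Fin (d + 1) => (-1 : ℝ)) p.2)) := by
  rw [← signMaskLeg_submatrix_eq_fromBlocks ρ Lc M fμ hμ hcoarse P,
    hessT_submatrix_of_dead_leg (packedEmb_injective M fμ hfμ hμ) (signMaskLeg_row_dead ρ Lc M fμ hcoarse P)
      (signMaskLeg_col_dead ρ Lc M fμ hcoarse P) V V' W,
    hessT_mul_leg]

variable {Lc} in
/-- [folklore] **`hessT_packedLeg_eq_perF` — THE SAME FOR A PERIODISED CHART KERNEL UNDER THE TORUS RULES**: with `P := perF M A` and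
`Ê·Â = Â = Â·Ê` (`Ê = perF M (axEc ρ Lc)`; `RelInvPeriodisedChart.perF_rules_of_relInv` ∕ `RelInvPeriodisedComb.perF_rules_comb`), the packed
leg's `hessT` against `e♯`-restricted jets is `hessT (perF M A) (V·D_σ) (V′·D_σ) (W·D_σ)` — the leg UNMASKED on `Idx M (Fib d)`, the currency of (P2‴). -/
theorem hessT_packedLeg_eq_perF (hfμ : Function.Injective fμ) (hμ : ∀ a : μ, ∃ m : Fin (d + 1), (fμ a).2 = Sum.inr m)
    (hcoarse : ∀ (s : ↥(pbox M)) (m : Fin (d + 1)), ((s, Sum.inr m) : Idx M (Fib d)) ∈ Set.range fμ ↔ Torus.proj Lc (s : Site (d + 1)) = 0)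
    {A : MKer (d + 1) (Fib d)} (hEA : perF M (axEc ρ Lc) * perF M A = perF M A) (hAE : perF M A * perF M (axEc ρ Lc) = perF M A)
    (V V' W : Matrix (Idx M (Fib d)) (Idx M (Fib d)) ℝ) :
    hessT
        (fromBlocks
          (Matrix.of fun (b b' : ↥(pbox M) × Fin (d + 1)) =>
            axEc ρ Lc (b.1 : Site (d + 1)) (b.1 : Site (d + 1)) (Sum.inl b.2) (Sum.inl b.2)
              * (axEc ρ Lc (b'.1 : Site (d + 1)) (b'.1 : Site (d + 1)) (Sum.inl b'.2) (Sum.inl b'.2)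
                * perF M A (b.1, Sum.inl b.2) (b'.1, Sum.inl b'.2)))
          (Matrix.of fun (b : ↥(pbox M) × Fin (d + 1)) (a : μ) =>
            axEc ρ Lc (b.1 : Site (d + 1)) (b.1 : Site (d + 1)) (Sum.inl b.2) (Sum.inl b.2) * perF M A (b.1, Sum.inl b.2) (fμ a))
          (-Matrix.of fun (a : μ) (b : ↥(pbox M) × Fin (d + 1)) =>
            axEc ρ Lc (b.1 : Site (d + 1)) (b.1 : Site (d + 1)) (Sum.inl b.2) (Sum.inl b.2) * perF M A (fμ a) (b.1, Sum.inl b.2))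
          (-((perF M A).submatrix fμ fμ)))
        (V.submatrix (Sum.elim (fun b : ↥(pbox M) × Fin (d + 1) => ((b.1, Sum.inl b.2) : Idx M (Fib d))) fμ)
          (Sum.elim (fun b : ↥(pbox M) × Fin (d + 1) => ((b.1, Sum.inl b.2) : Idx M (Fib d))) fμ))
        (V'.submatrix (Sum.elim (fun b : ↥(pbox M) × Fin (d + 1) => ((b.1, Sum.inl b.2) : Idx M (Fib d))) fμ)
          (Sum.elim (fun b : ↥(pbox M) × Fin (d + 1) => ((b.1, Sum.inl b.2) : Idx M (Fib d))) fμ))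
        (W.submatrix (Sum.elim (fun b : ↥(pbox M) × Fin (d + 1) => ((b.1, Sum.inl b.2) : Idx M (Fib d))) fμ)
          (Sum.elim (fun b : ↥(pbox M) × Fin (d + 1) => ((b.1, Sum.inl b.2) : Idx M (Fib d))) fμ))
      = hessT (perF M A)
          (V * Matrix.diagonal (fun p : Idx M (Fib d) => Sum.elim (fun _ : Fin (d + 1) => (1 : ℝ)) (fun _ : Fin (d + 1) => (-1 : ℝ)) p.2))
          (V' * Matrix.diagonal (fun p : Idx M (Fib d) => Sum.elim (fun _ : Fin (d + 1) => (1 : ℝ)) (fun _ : Fin (d + 1) => (-1 : ℝ)) p.2))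
          (W * Matrix.diagonal (fun p : Idx M (Fib d) => Sum.elim (fun _ : Fin (d + 1) => (1 : ℝ)) (fun _ : Fin (d + 1) => (-1 : ℝ)) p.2)) := by
  rw [hessT_packedLeg_eq_fullIndex ρ Lc M fμ hfμ hμ hcoarse (perF M A) V V' W, ← perF_axEc, hEA, hAE]

end FullIndex

/-! ## §5 The sign twist periodises: twisted jets are again `perF ∘ dper` of bi-localised kernels -/

section Twist

variable {d : ℕ} {F : Type*} [Fintype F] [DecidableEq F] (M : Fin (d + 1) → ℕ)

omit [Fintype F] [DecidableEq F] in
/-- [folklore] **fibre rescaling commutes with diagonal periodisation**: `dper M (scaleK u v U) = scaleK u v (dper M U)`. -/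
theorem dper_scaleK (u v : F → ℝ) (U : MKer (d + 1) F) : dper M (scaleK u v U) = scaleK u v (dper M U) := by
  funext x y a b
  simp only [dper_apply, scaleK_apply]
  rw [← tsum_mul_left, ← tsum_mul_right]

/-- [folklore] **`perF_dper_mul_diag` — A RIGHT DIAGONAL FIBRE FACTOR IS ABSORBED INTO THE PERIODISED JET**: `perF M (dper M U) · diagonal (v ∘ ·.2) =
perF M (dper M (scaleK 1 v U))` (`perF_scaleK` with `u := 1`, then `dper_scaleK`). -/
theorem perF_dper_mul_diag (v : F → ℝ) (U : MKer (d + 1) F) :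
    perF M (dper M U) * Matrix.diagonal (fun q : Idx M F => v q.2) = perF M (dper M (scaleK (fun _ => (1 : ℝ)) v U)) := by
  rw [dper_scaleK, perF_scaleK]
  have h1 : (Matrix.diagonal fun p : Idx M F => (fun _ : F => (1 : ℝ)) p.2) = 1 := Matrix.diagonal_one
  rw [h1, Matrix.one_mul]

/-- [folklore] **THE SIGN-TWISTED JET ON THE FIBRED TORUS**: `perF M (dper M U) · D_σ = perF M (dper M (scaleK 1 σ U))`, `σ = Sum.elim 1 (−1)` on `Fib d`. -/
theorem perF_dper_mul_signDiag (U : MKer (d + 1) (Fib d)) :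
    perF M (dper M U) * Matrix.diagonal (fun p : Idx M (Fib d) => Sum.elim (fun _ : Fin (d + 1) => (1 : ℝ)) (fun _ : Fin (d + 1) => (-1 : ℝ)) p.2)
      = perF M (dper M (scaleK (fun _ => (1 : ℝ)) (Sum.elim (fun _ : Fin (d + 1) => (1 : ℝ)) (fun _ : Fin (d + 1) => (-1 : ℝ))) U)) :=
  perF_dper_mul_diag M _ U

omit [Fintype F] [DecidableEq F] in
/-- [folklore] **A UNIT-MODULUS FIBRE TWIST KEEPS `BiLoc` WITH THE SAME CONSTANT** (`HessKerRate.biLoc_scaleK` with `|1| ≤ 1`, `|v| ≤ 1`). -/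
theorem biLoc_scaleK_unit {v : F → ℝ} (hv : ∀ b, |v b| ≤ 1) {U : MKer (d + 1) F} {p q : Fin (d + 1) → ℤ} {C δ : ℝ}
    (hU : BiLoc U p q C δ) : BiLoc (scaleK (fun _ => (1 : ℝ)) v U) p q C δ := by
  have h := biLoc_scaleK (u := fun _ : F => (1 : ℝ)) (U := 1) (U' := 1) (fun _ => by simp) hv hU
  simpa using h

/-- [folklore] the sign on `Fib d` has modulus `1`. -/
theorem abs_signFib_le_one (f : Fib d) : |Sum.elim (fun _ : Fin (d + 1) => (1 : ℝ)) (fun _ : Fin (d + 1) => (-1 : ℝ)) f| ≤ 1 := by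
  rcases f with α | m <;> simp

/-- [folklore] **THE SIGN-TWISTED JET IS BI-LOCALISED with the same data**. -/
theorem biLoc_signTwist {U : MKer (d + 1) (Fib d)} {p q : Fin (d + 1) → ℤ} {C δ : ℝ} (hU : BiLoc U p q C δ) :
    BiLoc (scaleK (fun _ => (1 : ℝ)) (Sum.elim (fun _ : Fin (d + 1) => (1 : ℝ)) (fun _ : Fin (d + 1) => (-1 : ℝ))) U) p q C δ :=
  biLoc_scaleK_unit abs_signFib_le_one hU

end Twist

end Summit.QuantumFields.BalabanUV.Beta.FP.PackedLegFullIndex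

end
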